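import Summits.QuantumFields.BalabanUV.Beta.FP.BiLaplaceTwoLevel
import Literature.MathematicalPhysics.QuantumFieldTheory.Balaban1983to89.Beta.ResolventCompositionStepB

/-!
# `BalabanUV.Beta.FP.BiLaplaceBlockResponse` — road «FP» for binder row D1, DESIGN ROW **GHOST-STEP**, brick (g1) (owner d1-p3 gen 13, `N2B-DESIGN.md` v1.2 §6):
# THE BLOCK-SUM RESPONSE KERNEL `Hb` OF an2's BLOCK-CONSTRAINED BI-LAPLACIAN SYSTEM (the scalar ∕ ghost analogue of the minimiser columns `ℋ = wH`) — the tempered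
# solution of (EL_b) `L(Lλ) = ω∘quo` (NO force), (M_b) `blockSum_N λ = δ_{·,y₀}` — with its identities, decay, uniqueness, and THE TWO-LEVEL SUPERPOSITION
# `Sb_{N′}(·, x′) − Sb_M(·, x′) = Σ'_y blockSum_M(Sb_{N′}(·,x′))(y) · Hb_M(·, y)` (every `d`, `N′ = M·L`); UNCONDITIONAL

HONEST DEPENDENCY (page 1, mandatory): continuum YM on T⁴ ⇐ BetaPertH ∧ nine spine estimates (0/9 proved); BetaPertH ⇐ (D1) ∧ (D4) ∧ CAP+tail;
G-an2-4 gates asym, D1 and NE2/3/4.  HONEST FRAMING (cell contract, verbatim): «discharging `BetaPertH` makes Bałaban's UV stability UNCONDITIONAL —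
a real constructive-QFT result; it is NOT the continuum limit and NOT the Clay problem.»  THIS MODULE is [folklore]-grade bookkeeping over an2-g6's
`BiLaplaceBlockKKT` (`fundCfgB`, `fundCfgB_EL`, `fundCfgB_M`, `invKernelB_decay_l1`, `re0_lapN`) ∕ `BiLaplaceBlockGreen` (`unique_of_solvesB`, temperedness) and the owner's
g13 `BiLaplaceTwoLevel` (`SbCol_sub_eq_of_solvesB`).  DEFINITIONS `srcM`, `hcolL`, `hcolW`, `hB`, `hWB`, `Hb`, `HWb` assert nothing; nothing cited, 0 sorry; 0 estimates of
Bałaban's constrained objects; 0∕4 row-D1 binders; NOT the perfect level, NOT the ghost step law, NOT (STEP)∕SDF, NOT D1, NOT BetaPertH, NOT continuum, NOT Clay.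
«not in print; our bookkeeping».
ABSOLUTE RULE (cell charter, verbatim): «No internally-minted statement may enter as a cited fact. Every hypothesis is either kernel-proved in this package or a
verbatim quotation of a PUBLISHED theorem with page reference. The manuscript(s) under audit are NOT citable for their own disputed steps — they are the thing
under adjudication; programme-internal (2001/route/tribunal) claims are never citable.»

WHY (`N2B-DESIGN.md` v1.2).  Road FP's (STEP) defect is a ghost word in the columns of `Sb` (`TwoLevelDefectPairing`); its expected vanishing mechanism at the second
moment is the EXACT two-level structure of the scalar block system (`BiLaplaceTwoLevel`: `SbCol_{N′} − SbCol_M` IS the level-`M` response to its own `M`-block sums).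
The response kernel itself — the scalar companion of `KernelSpecInstance.wH` — was not in the tree; this file supplies it with exactly the letters an5's superposition
arguments use for `wH` (EL, M, decay, temperedness, canonical uniqueness) and writes the two-level law as a SUPERPOSITION over it.

CONTENT (every `d`, `N ≥ 1`; §4 for `N′ = M·L`).
* §1 `srcM` (unit source on the block-sum row), `mulVec_srcM`, `hcolL` ∕ `hcolW` (complex column), `hB` ∕ `hWB` (real parts), **`hB_EL`** (`L(L hB) x = hWB (quo N x)`: NO force),
  **`hB_M`** (`blockSum_N hB y = [y = 0]`), `decay_hB`, `decay_hWB`, `hB_bdd_summable`.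
* §2 translated kernel `Hb x y₀ := hB (x − N•y₀)`, `HWb y y₀ := hWB (y − y₀)`: `Hb_EL`, `Hb_M` (`blockSum_N (Hb · y₀) y = [y = y₀]`), `solvesB_Hb`, `tempered_Hb`, `tempered_HWb`,
  **`eq_Hb_of_solvesB`** (canonical: any tempered solution of the force-free system with data `δ_{·,y₀}` is `(Hb · y₀, HWb · y₀)`).
* §3 superpositions with summable data `c`: `solvesB_sup` (`Σ'_y c y · Hb · y` solves the force-free system with data `c`), `tempered_sup`.
* §4 **`SbCol_sub_eq_tsum_Hb`** (`N′ = M·L`): `SbCol_{N′} x′ x − SbCol_M x′ x = Σ'_y blockSum_M (SbCol_{N′} x′) y · Hb_M x y` — the scalar two-level law as a superposition.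
Provenance: road «FP» OWNER, unit b2b-balaban-beta-d1-p3 gen 13 (prover-b2b-balaban-beta-d1-p3-g13-0), 2026-08-21; no existing file touched.
-/

noncomputable section

namespace Summit.QuantumFields.BalabanUV.Beta.FP.BiLaplaceBlockResponse

open Literature.Probability.LatticeModels (TorusSite Torus.proj)
open Literature.MathematicalPhysics.QuantumFieldTheory
open Literature.MathematicalPhysics.QuantumFieldTheory.Balaban1983to89
open Literature.MathematicalPhysics.QuantumFieldTheory.Balaban1983to89.Beta
open AffineAveraging (Form0 dz codiff₁ box toSite blockSum)
open LatticeForm (repZ quo)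
open KernelSpecInstance (re0 re0_apply exp_quo_le)
open KKTFluctuationUnique (Tempered0 abs_le_of_decay510)
open KKTFluctuationEnergy (summable_mul_of_bdd summable_mul_of_bdd' summable_shift_sub)
open KKTFluctuationKernel (blockSum_shift)
open BlochFibreUniqueness (quo_add_zsmul)
open BlochFibreMatrix (stencil)
open FibreInverseDecay (invKernel)
open ScalarBlockKKT (IdxS CfgS cfgL cfgW re0_blockSum lapN_shiftS)
open BiLaplaceBlockKKT (fundCfgB fundCfgB_EL fundCfgB_M invKernelB_decay_l1 re0_lapN pieceMatrixB Sb Wb)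
open BiLaplaceBlockGreen (SbCol SolvesB unique_of_solvesB tempered_SbCol SbCol_bdd_summable blockSum_SbCol)
open DecimatedMomentLimit (summable_of_decay510)
open ResolventCompositionStepB (dz_tsum codiff₁_tsum blockSum_tsum)
open B12Sec2to5 (l1 l1_nonneg Decay510)
open BiLaplaceTwoLevel (SbCol_sub_eq_of_solvesB tempered_sub)

variable {d N : ℕ}

/-! ## §1 The block-sum response column at block `0` -/

section Column

/-- [our object] The unit source on the block-sum row (M_b) of an2's squared-Laplacian block system. -/
def srcM : IdxS (d + 1) N → ℂ := fun i =>
  match i with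
  | Sum.inl _ => 0
  | Sum.inr _ => 1

variable [NeZero N]

/-- [folklore] Matrix action on the block-sum source picks the `inr` column. -/
theorem mulVec_srcM (K : Matrix (IdxS (d + 1) N) (IdxS (d + 1) N) ℂ) (i : IdxS (d + 1) N) :
    K.mulVec srcM i = K i (Sum.inr ()) := by
  simp [Matrix.mulVec, dotProduct, srcM, Fintype.sum_sum_type]

/-- [our object] The complex fine field of the block-sum response column. -/
def hcolL : Form0 (d + 1) ℂ := cfgL (fundCfgB (N := N) srcM)

/-- [our object] Its complex coarse multiplier. -/
def hcolW : Form0 (d + 1) ℂ := cfgW (fundCfgB (N := N) srcM)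

/-- [our object] THE REAL BLOCK-SUM RESPONSE COLUMN `hB := Re λ`: unit block sum prescribed on block `0`, no force. -/
def hB : Form0 (d + 1) ℝ := re0 (hcolL (N := N))

/-- [our object] Its real coarse multiplier. -/
def hWB : Form0 (d + 1) ℝ := re0 (hcolW (N := N))

/-- [folklore] (EL_b) for the complex column: `L(L λ) x = ω (quo N x)` — NO force term (the source sits on the block-sum row). -/
theorem hcolL_EL (x : AffineAveraging.Site (d + 1)) :
    codiff₁ (dz (codiff₁ (dz (hcolL (N := N))))) x = hcolW (N := N) (quo N x) := by
  have h := fundCfgB_EL (N := N) (srcM (d := d)) x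
  have h0 : (if quo N x = 0 then srcM (d := d) (N := N) (Sum.inl (Torus.proj N x)) else 0) = 0 := by
    split_ifs <;> rfl
  rw [h0] at h
  simp only [hcolL, hcolW]
  linear_combination h

/-- [folklore] (M_b) for the complex column: `blockSum_N λ y = [y = 0]`. -/
theorem hcolL_M (y : AffineAveraging.Site (d + 1)) :
    blockSum N (hcolL (N := N)) y = if y = 0 then 1 else 0 := by
  have h := fundCfgB_M (N := N) (srcM (d := d)) y
  simp only [hcolL]
  rw [h]
  split_ifs <;> rfl

/-- [our proof] **(EL_b) FOR THE BLOCK-SUM RESPONSE COLUMN**: `L(L hB) x = hWB (quo N x)` — no force. -/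
theorem hB_EL (x : AffineAveraging.Site (d + 1)) :
    codiff₁ (dz (codiff₁ (dz (hB (N := N))))) x = hWB (N := N) (quo N x) := by
  have h := congrArg Complex.re (hcolL_EL (N := N) x)
  have h1 : (codiff₁ (dz (codiff₁ (dz (hcolL (N := N))))) x).re = codiff₁ (dz (codiff₁ (dz (hB (N := N))))) x := by
    have := congr_fun (re0_lapN (codiff₁ (dz (hcolL (N := N))))) x
    rw [re0_apply] at this
    rw [this, re0_lapN]; rfl
  rw [h1] at h
  rw [h]
  rfl

/-- [our proof] **(M_b) FOR THE BLOCK-SUM RESPONSE COLUMN**: `blockSum_N hB y = [y = 0]`. -/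
theorem hB_M (y : AffineAveraging.Site (d + 1)) : blockSum N (hB (N := N)) y = if y = 0 then 1 else 0 := by
  have h := congrArg Complex.re (hcolL_M (N := N) y)
  rw [hB, ← re0_blockSum, re0_apply, h]
  split_ifs <;> simp

/-- [folklore] Decay of the response column from the origin, AT FIXED `N` (witnesses `δ/N`, `M e^{δ(d+1)}` from `invKernelB_decay_l1`). -/
theorem decay_hB : ∃ δ C : ℝ, 0 < δ ∧ 0 ≤ C ∧ Decay510 (hB (d := d) (N := N)) C δ := by
  obtain ⟨δ, M, hδ, hM, h⟩ := invKernelB_decay_l1 (N := N) (d := d)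
  have hN : (0 : ℝ) < N := by exact_mod_cast Nat.pos_of_ne_zero (NeZero.ne N)
  refine ⟨δ / N, M * Real.exp (δ * (d + 1)), div_pos hδ hN, by positivity, fun z => ?_⟩
  have hz := h (Sum.inl (Torus.proj N z)) (Sum.inr ()) (quo N z)
  calc |hB (d := d) (N := N) z| ≤ ‖hcolL (d := d) (N := N) z‖ := Complex.abs_re_le_norm _
    _ = ‖(invKernel (stencil (d + 1)) (pieceMatrixB (N := N)) (quo N z)).mulVec srcM (Sum.inl (Torus.proj N z))‖ := rfl
    _ = ‖invKernel (stencil (d + 1)) (pieceMatrixB (N := N)) (quo N z) (Sum.inl (Torus.proj N z)) (Sum.inr ())‖ := by rw [mulVec_srcM]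
    _ ≤ M * Real.exp (-(δ * l1 (quo N z))) := hz
    _ ≤ M * (Real.exp (δ * (d + 1)) * Real.exp (-(δ / N) * l1 z)) := mul_le_mul_of_nonneg_left (exp_quo_le (N := N) hδ z) hM
    _ = M * Real.exp (δ * (d + 1)) * Real.exp (-(δ / N) * l1 z) := by ring

/-- [folklore] Decay of the coarse multiplier of the response column (in the block index), AT FIXED `N`. -/
theorem decay_hWB : ∃ δ C : ℝ, 0 < δ ∧ 0 ≤ C ∧ Decay510 (hWB (d := d) (N := N)) C δ := by
  obtain ⟨δ, M, hδ, hM, h⟩ := invKernelB_decay_l1 (N := N) (d := d)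
  refine ⟨δ, M, hδ, hM, fun y => ?_⟩
  have hy := h (Sum.inr ()) (Sum.inr ()) y
  calc |hWB (d := d) (N := N) y| ≤ ‖hcolW (d := d) (N := N) y‖ := Complex.abs_re_le_norm _
    _ = ‖(invKernel (stencil (d + 1)) (pieceMatrixB (N := N)) y).mulVec srcM (Sum.inr ())‖ := rfl
    _ = ‖invKernel (stencil (d + 1)) (pieceMatrixB (N := N)) y (Sum.inr ()) (Sum.inr ())‖ := by rw [mulVec_srcM]
    _ ≤ M * Real.exp (-(δ * l1 y)) := hy
    _ = M * Real.exp (-δ * l1 y) := by rw [neg_mul]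

/-- [folklore] The response column is bounded and summable. -/
theorem hB_bdd_summable : ∃ C : ℝ, 0 ≤ C ∧ (∀ z, |hB (d := d) (N := N) z| ≤ C) ∧ Summable (hB (d := d) (N := N)) := by
  obtain ⟨δ, C, hδ, hC, h⟩ := decay_hB (N := N) (d := d)
  exact ⟨C, hC, fun z => abs_le_of_decay510 hδ h z, summable_of_decay510 hδ h⟩

end Column

/-! ## §2 The translated kernel `Hb x y₀`: unit block sum prescribed on block `y₀` -/

section Kernel

variable [NeZero N]

/-- [our object] THE BLOCK-SUM RESPONSE KERNEL: the field at `x` of the force-free solution with unit block sum on block `y₀` (block translation of `hB`). -/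
def Hb (x y₀ : AffineAveraging.Site (d + 1)) : ℝ := hB (N := N) (x - (N : ℤ) • y₀)

/-- [our object] Its coarse multiplier. -/
def HWb (y y₀ : AffineAveraging.Site (d + 1)) : ℝ := hWB (N := N) (y - y₀)

/-- [our proof] (EL_b) for the kernel: `L(L Hb(·, y₀)) x = HWb (quo N x) y₀`. -/
theorem Hb_EL (y₀ x : AffineAveraging.Site (d + 1)) :
    codiff₁ (dz (codiff₁ (dz (fun z => Hb (N := N) z y₀)))) x = HWb (N := N) (quo N x) y₀ := by
  have h := hB_EL (N := N) (x - (N : ℤ) • y₀)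
  have hq : quo N (x - (N : ℤ) • y₀) = quo N x - y₀ := by
    rw [sub_eq_add_neg, ← smul_neg, quo_add_zsmul, ← sub_eq_add_neg]
  have e0 : codiff₁ (dz (fun z => Hb (N := N) z y₀)) = fun z => codiff₁ (dz (hB (d := d) (N := N))) (z - (N : ℤ) • y₀) := by
    funext z; simp only [Hb]; exact lapN_shiftS _ _ z
  have hL : codiff₁ (dz (codiff₁ (dz (fun z => Hb (N := N) z y₀)))) x = codiff₁ (dz (codiff₁ (dz (hB (d := d) (N := N))))) (x - (N : ℤ) • y₀) := by
    rw [e0]; exact lapN_shiftS _ _ x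
  rw [hL, h, hq]
  rfl

/-- [our proof] (M_b) for the kernel: `blockSum_N (Hb(·, y₀)) y = [y = y₀]`. -/
theorem Hb_M (y₀ y : AffineAveraging.Site (d + 1)) :
    blockSum N (fun z => Hb (N := N) z y₀) y = if y = y₀ then 1 else 0 := by
  simp only [Hb]
  rw [blockSum_shift (N := N) (hB (N := N)) y₀ y, hB_M]
  by_cases h : y = y₀
  · simp [h]
  · rw [if_neg (sub_ne_zero.mpr h), if_neg h]

/-- [our proof] The kernel column solves the force-free system with the unit block-sum datum at `y₀`. -/
theorem solvesB_Hb (y₀ : AffineAveraging.Site (d + 1)) :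
    SolvesB N 0 (fun y => if y = y₀ then (1 : ℝ) else 0) (fun z => Hb (N := N) z y₀) (fun y => HWb (N := N) y y₀) where
  el x := by rw [Hb_EL, Pi.zero_apply, add_zero]
  mean y := Hb_M (N := N) y₀ y

/-- [folklore] The kernel column is tempered (bounded). -/
theorem tempered_Hb (y₀ : AffineAveraging.Site (d + 1)) : Tempered0 (fun z => Hb (N := N) z y₀) := by
  obtain ⟨C, _, hb, _⟩ := hB_bdd_summable (N := N) (d := d)
  exact Tempered0.of_bounded fun z => hb _

/-- [folklore] Its multiplier is tempered (bounded). -/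
theorem tempered_HWb (y₀ : AffineAveraging.Site (d + 1)) : Tempered0 (fun y => HWb (N := N) y y₀) := by
  obtain ⟨δ, C, hδ, _, h⟩ := decay_hWB (N := N) (d := d)
  exact Tempered0.of_bounded (B := C) fun y => abs_le_of_decay510 hδ h (y - y₀)

/-- [our proof] **THE RESPONSE KERNEL IS CANONICAL**: every tempered pair solving the force-free system with the unit block-sum datum at `y₀` is `(Hb(·, y₀), HWb(·, y₀))`. -/
theorem eq_Hb_of_solvesB {y₀ : AffineAveraging.Site (d + 1)} {lam ω : Form0 (d + 1) ℝ}
    (h : SolvesB N 0 (fun y => if y = y₀ then (1 : ℝ) else 0) lam ω) (hlam : Tempered0 lam) (hω : Tempered0 ω) :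
    lam = (fun z => Hb (N := N) z y₀) ∧ ω = fun y => HWb (N := N) y y₀ :=
  unique_of_solvesB h (solvesB_Hb y₀) hlam hω (tempered_Hb y₀) (tempered_HWb y₀)

end Kernel


/-! ## §3 Superpositions of the response kernel with summable block-sum data -/

section Superposition

variable [NeZero N]

/-- [our proof] **A SUPERPOSITION OF RESPONSE COLUMNS WITH SUMMABLE DATA `c` SOLVES THE FORCE-FREE SYSTEM WITH DATA `c`**:
`λ_c := Σ'_y c y · Hb(·, y)` satisfies (EL_b) with the coarse multiplier `y′ ↦ Σ'_y c y · HWb(y′, y)` and (M_b) `blockSum_N λ_c = c`. -/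
theorem solvesB_sup {c : Form0 (d + 1) ℝ} (hc : Summable c) :
    SolvesB N 0 c (fun x => ∑' y, c y * Hb (N := N) x y) (fun y' => ∑' y, c y * HWb (N := N) y' y) where
  el x := by
    obtain ⟨C, _, hb, _⟩ := hB_bdd_summable (N := N) (d := d)
    -- bounds on the translated columns and their derivatives
    have b0 : ∀ y z, |Hb (N := N) z y| ≤ C := fun y z => hb _
    have b1 : ∀ y κ z, |dz (fun z => Hb (N := N) z y) κ z| ≤ 2 * C := fun y κ z => KKTFluctuationEnergy.abs_dz_le (b0 y) κ z
    have b2 : ∀ y z, |codiff₁ (dz (fun z => Hb (N := N) z y)) z| ≤ (d + 1 : ℕ) * (2 * (2 * C)) :=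
      fun y z => KKTFluctuationEnergy.abs_codiff₁_le (b1 y) z
    have b3 : ∀ y κ z, |dz (codiff₁ (dz (fun z => Hb (N := N) z y))) κ z| ≤ 2 * ((d + 1 : ℕ) * (2 * (2 * C))) :=
      fun y κ z => KKTFluctuationEnergy.abs_dz_le (b2 y) κ z
    -- summability at each derivative stage
    have s0 : ∀ z, Summable fun y => c y * Hb (N := N) z y := fun z => summable_mul_of_bdd' hc (fun y => b0 y z)
    have s1 : ∀ κ z, Summable fun y => c y * dz (fun z => Hb (N := N) z y) κ z :=
      fun κ z => summable_mul_of_bdd' hc (fun y => b1 y κ z)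
    have s2 : ∀ z, Summable fun y => c y * codiff₁ (dz (fun z => Hb (N := N) z y)) z :=
      fun z => summable_mul_of_bdd' hc (fun y => b2 y z)
    have s3 : ∀ κ z, Summable fun y => c y * dz (codiff₁ (dz (fun z => Hb (N := N) z y))) κ z :=
      fun κ z => summable_mul_of_bdd' hc (fun y => b3 y κ z)
    -- pass the four finite stencils through the series
    have e1 : dz (fun x => ∑' y, c y * Hb (N := N) x y) = fun κ x => ∑' y, c y * dz (fun z => Hb (N := N) z y) κ x := by
      rw [dz_tsum (f := fun y x => c y * Hb (N := N) x y) s0]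
      funext κ x; refine tsum_congr fun y => ?_; simp only [dz]; ring
    have e2 : codiff₁ (dz (fun x => ∑' y, c y * Hb (N := N) x y)) = fun x => ∑' y, c y * codiff₁ (dz (fun z => Hb (N := N) z y)) x := by
      rw [e1, codiff₁_tsum (f := fun y κ x => c y * dz (fun z => Hb (N := N) z y) κ x) s1]
      funext x; refine tsum_congr fun y => ?_; simp only [codiff₁, Finset.mul_sum]
      exact Finset.sum_congr rfl fun κ _ => by ring
    have e3 : dz (codiff₁ (dz (fun x => ∑' y, c y * Hb (N := N) x y)))
        = fun κ x => ∑' y, c y * dz (codiff₁ (dz (fun z => Hb (N := N) z y))) κ x := by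
      rw [e2, dz_tsum (f := fun y x => c y * codiff₁ (dz (fun z => Hb (N := N) z y)) x) s2]
      funext κ x; refine tsum_congr fun y => ?_; simp only [dz]; ring
    have e4 : codiff₁ (dz (codiff₁ (dz (fun x => ∑' y, c y * Hb (N := N) x y)))) x
        = ∑' y, c y * codiff₁ (dz (codiff₁ (dz (fun z => Hb (N := N) z y)))) x := by
      rw [e3, codiff₁_tsum (f := fun y κ x => c y * dz (codiff₁ (dz (fun z => Hb (N := N) z y))) κ x) s3]
      refine tsum_congr fun y => ?_; simp only [codiff₁, Finset.mul_sum]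
      exact Finset.sum_congr rfl fun κ _ => by ring
    rw [e4, Pi.zero_apply, add_zero]
    exact tsum_congr fun y => by rw [Hb_EL]
  mean y₀ := by
    obtain ⟨C, _, hb, _⟩ := hB_bdd_summable (N := N) (d := d)
    have s0 : ∀ z, Summable fun y => c y * Hb (N := N) z y := fun z => summable_mul_of_bdd' hc (fun y => hb _)
    rw [blockSum_tsum N (f := fun y x => c y * Hb (N := N) x y) s0]
    have e : ∀ y, blockSum N (fun x => c y * Hb (N := N) x y) y₀ = c y * (if y₀ = y then 1 else 0) := fun y => by
      rw [← Hb_M (N := N) y y₀]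
      simp only [blockSum, Finset.mul_sum]
    rw [tsum_congr e, tsum_eq_single y₀ (fun y hy => by rw [if_neg (Ne.symm hy), mul_zero]), if_pos rfl, mul_one]

/-- [folklore] The superposition and its multiplier are tempered (bounded by `C·Σ|c|`). -/
theorem tempered_sup {c : Form0 (d + 1) ℝ} (hc : Summable c) :
    Tempered0 (fun x => ∑' y, c y * Hb (N := N) x y) ∧ Tempered0 (fun y' => ∑' y, c y * HWb (N := N) y' y) := by
  obtain ⟨C, hC, hb, _⟩ := hB_bdd_summable (N := N) (d := d)
  obtain ⟨δ, CW, hδ, hCW, hW⟩ := decay_hWB (N := N) (d := d)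
  have hbW : ∀ y' y, |HWb (N := N) y' y| ≤ CW := fun y' y => abs_le_of_decay510 hδ hW _
  have key : ∀ {g : AffineAveraging.Site (d + 1) → ℝ} {B : ℝ}, (∀ y, |g y| ≤ B) → |∑' y, c y * g y| ≤ (∑' y, |c y|) * B := by
    intro g B hg
    have hs : Summable fun y => c y * g y := summable_mul_of_bdd' hc hg
    calc |∑' y, c y * g y| ≤ ∑' y, |c y * g y| := by
          have h := norm_tsum_le_tsum_norm (f := fun y => c y * g y) (by simpa only [Real.norm_eq_abs] using hs.abs)
          simpa only [Real.norm_eq_abs] using h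
      _ ≤ ∑' y, |c y| * B := Summable.tsum_le_tsum (fun y => by rw [abs_mul]; exact mul_le_mul_of_nonneg_left (hg y) (abs_nonneg _))
          hs.abs (hc.abs.mul_right B)
      _ = (∑' y, |c y|) * B := tsum_mul_right
  exact ⟨Tempered0.of_bounded fun x => key (fun y => hb _), Tempered0.of_bounded fun y' => key (fun y => hbW y' y)⟩

end Superposition

/-! ## §4 The two-level law of the scalar block system as a superposition over the response kernel -/

section TwoLevel

variable {N' M L : ℕ} [NeZero N'] [NeZero M]

/-- [our proof] **THE SCALAR TWO-LEVEL LAW AS A SUPERPOSITION** (`N′ = M·L`, every `d`, every source `x′`):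
`SbCol_{N′} x′ x − SbCol_M x′ x = Σ'_y blockSum_M (SbCol_{N′} x′) y · Hb_M x y` — the level-`N′` Green column is the level-`M` one plus the level-`M` block-sum
RESPONSE to its own `M`-block sums, EXACTLY (`BiLaplaceTwoLevel.SbCol_sub_eq_of_solvesB` fed with `solvesB_sup`).  The scalar companion of an5's covariance
decomposition — with NO gauge term. -/
theorem SbCol_sub_eq_tsum_Hb (hN : N' = M * L) (x' x : AffineAveraging.Site (d + 1)) :
    SbCol (N := N') x' x - SbCol (N := M) x' x = ∑' y, blockSum M (SbCol (N := N') x') y * Hb (N := M) x y := by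
  obtain ⟨C, _, _, hSs⟩ := SbCol_bdd_summable (N := N') (d := d)
  have hc : Summable (fun y => blockSum M (SbCol (N := N') x') y) :=
    KKTFluctuationEnergy.summable_blocks (N := M) (hSs x')
  obtain ⟨hT, hTω⟩ := tempered_sup (N := M) hc
  have h := (SbCol_sub_eq_of_solvesB (N' := N') (M := M) (L := L) hN x' (solvesB_sup (N := M) hc) hT hTω).1 x
  linarith

end TwoLevel

end Summit.QuantumFields.BalabanUV.Beta.FP.BiLaplaceBlockResponse

end
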